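/-
Copyright (c) 2026 the pub-hodgecm-mathlib formalisation cell (harness21).  Prover seat hodgecm-mathlib-K2E4-p11 (g6), Track B ∕ K2-LIT, h413 = `stmt-HodgeConjecture-24833`,
line `K2_E1_TraceFormulaBeta`, campaign «5Res ENDGAME BY FAMILIES» (ROADCARD `K2/K2E1-plan/g7/ROADCARD-5Res-FAMILIES.K2E1-plan-g7.md`), P1 = C4 (dealer K2E1-plan (g7) deal (164)
2026-09-04T11:50:34Z): ★ T4a `K2E1VerticalLineContourShift` with a FINSET of simple real poles between the lines — Mathlib-only complex analysis.
-/
import Summits.HodgeConjecture.HodgeConjecture.Theorems.K2E1VerticalLineContourShift   -- ★ T4a p859747 (K2E1-p12): `integral_inv_vertical_mul_vertical`, `integral_vertical_eq_of_differentiableOn`, `tendsto_intervalIntegral_horizontal_of_sq_decay`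
import HarnessLib

/-!
# C4 — `K2E1VerticalLineContourShiftMulti`: moving `∫_ℝ F(σ₂+iy) dy` to `∫_ℝ F(σ₁+iy) dy` across FINITELY MANY simple real poles `c_j ∈ (σ₁, σ₂)`
# (`∫_ℝ F(σ₂+iy) dy = ∫_ℝ F(σ₁+iy) dy + 2π·Σ_j Res_{z=c_j} F`), Mathlib-only over ★ T4a

Track B ∕ K2-LIT, crux h413 = `stmt-HodgeConjecture-24833`, route of record `HCCMUnconditional`; cell `hodgecm-mathlib`, squad K2, ENGINE E1; dealer K2E1-plan (g7) deal (164) («P1 = C4: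
★ T4a's vertical-line shift with a FINSET of simple real poles `z_j ∈ (½, σ₀)`; subtract the principal parts first and shift the holomorphic remainder ONCE»).  THEOREMS ONLY (no `def`,
no `instance`, no `notation`, no `sorry`; default heartbeats); lane `--supports stmt-HodgeConjecture-24833 --as helper` (count-neutral).  GENERIC complex analysis, no automorphic object.

THE MATHEMATICS ([Titchmarsh1939, §3.1–§3.12]; [MoeglinWaldspurger1995, II.2.1–II.2.4, IV.1.11]: where it is used — the contour shift of the inner product formula of a pseudo-Eisenstein
family across the finitely many (real, simple) poles of its intertwining operator in `(½, σ₀)`).  ★ T4a treats ONE pole at `z = 1` with the kernel `2∕((z−1)(z+1))`.  Here: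
§1 THE KERNEL WITH A SIMPLE POLE AT A REAL `c` AND COMPANION POLE AT A REAL `a < σ₁`: `k_{c,a}(z) = (c−a)∕((z−c)(z−a))` — residue `1` at `c`, `O(1∕y²)` on vertical lines uniformly in
`x`, and by ★ `integral_inv_vertical_mul_vertical` its line integrals are `∫_ℝ k(σ+iy) dy = 0` for `σ > c` and `= −2π` for `a < σ < c` (§1); `(z−c)·k_{c,a}(z) → 1` at `c` and
`(z−c′)·k_{c,a}(z) → 0` at every `c′ ∉ {c, a}`.
§2 REMOVABLE SINGULARITIES ON A FINITE SET: `f` holomorphic on `U ∖ S` (`S` finite) with `(z−c)·f(z) → 0` at each `c ∈ S` has a holomorphic continuation `g` on `U`, `g = f` off `S`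
(induction on `S` over Mathlib's one-point `Complex.differentiableOn_update_limUnder_of_isLittleO`).
§3 THE SHIFT **`integral_vertical_eq_integral_vertical_add_sum_residues`**: `σ₁ < σ₂`, a finset `S` of reals in `(σ₁, σ₂)`, `U` open ⊇ the closed strip, `F` holomorphic on `U ∖ S`
with `(z−c)·F(z) → ρ_c` at each `c ∈ S`, integrable on both lines, `‖F(x+iy)‖ ≤ K∕y²` for `x ∈ [σ₁, σ₂]`, `|y| ≥ 1` ⟹ **`∫_ℝ F(σ₂+iy) dy = ∫_ℝ F(σ₁+iy) dy + 2π·Σ_{c∈S} ρ_c`**: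
`G := F − Σ_c ρ_c·k_{c, σ₁−1}` has `(z−c)·G → 0` at every `c ∈ S` (the residues cancel, the other kernels are regular at `c`), so extends holomorphically across `S` (§2); ★ T4a §2 shifts
the extension (decay `(K + Σ‖ρ_c‖(c−a))∕y²`), and §1 evaluates `Σ_c ρ_c ∫ k_c` on the two lines (`0` on `σ₂`, `−2π` each on `σ₁`).
HONEST LABEL: HC_CM is proved only modulo the 7 printed citations (2 remaining named inputs: hLiu418 = `stmt-HodgeConjecture-24832`, h413 = `stmt-HodgeConjecture-24833`) until rung 0
closes; this file asserts no named fact, closes no socket; count-neutral; letter-free, Mathlib-only over ★ T4a.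

## References
* [Titchmarsh1939] E. C. Titchmarsh, *The Theory of Functions* (2nd ed., 1939), §3.1 (Cauchy's residue theorem), §3.12.
* [MoeglinWaldspurger1995] C. Mœglin, J.-L. Waldspurger, *Spectral decomposition and Eisenstein series* (1995), II.2.1–II.2.4, IV.1.11.
-/

set_option autoImplicit false
set_option linter.dupNamespace false  -- the mandated namespace repeats the summit's segment (`HodgeConjecture.HodgeConjecture`)

noncomputable section

open MeasureTheory Measure Set Filter Topology Complex Asymptotics
open scoped Real
open Summit.HodgeConjecture.HodgeConjecture.Cruxes.H413.K2E1VerticalLineContourShift (integral_inv_vertical_mul_vertical integrable_inv_vertical_mul_vertical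
  integral_vertical_eq_of_differentiableOn tendsto_intervalIntegral_horizontal_of_sq_decay)

namespace Summit.HodgeConjecture.HodgeConjecture.Cruxes.H413.K2E1VerticalLineContourShiftMulti

/-! ## §1 The kernel `k_{c,a}(z) = (c − a)∕((z − c)(z − a))`: line integrals, integrability, decay, holomorphy, residues -/

/-- **`∫_ℝ k_{c,a}(σ+iy) dy = 0` for `a < c < σ`** (both poles to the left of the line; ★ `integral_inv_vertical_mul_vertical` with `α = σ − c`, `β = σ − a`, both positive).
[cite: Titchmarsh1939, §3.12] -/
theorem integral_kernel_vertical_of_lt {a c σ : ℝ} (hac : a < c) (hcσ : c < σ) :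
    ∫ y : ℝ, ((c - a : ℝ) : ℂ) * ((((σ : ℂ) + y * I) - c) * (((σ : ℂ) + y * I) - a))⁻¹ = 0 := by
  have hα : σ - c ≠ 0 := by linarith
  have hβ : σ - a ≠ 0 := by linarith
  have h : (fun y : ℝ => ((c - a : ℝ) : ℂ) * ((((σ : ℂ) + y * I) - c) * (((σ : ℂ) + y * I) - a))⁻¹) =
      fun y : ℝ => ((c - a : ℝ) : ℂ) * ((((σ - c : ℝ) : ℂ) + y * I) * (((σ - a : ℝ) : ℂ) + y * I))⁻¹ := by
    funext y; push_cast; ring_nf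
  rw [h, MeasureTheory.integral_const_mul, integral_inv_vertical_mul_vertical hα hβ (by linarith), abs_of_pos (by linarith : 0 < σ - c), abs_of_pos (by linarith : 0 < σ - a),
    div_self hα, div_self hβ, sub_self, zero_div, ofReal_zero, mul_zero]

/-- **`∫_ℝ k_{c,a}(σ+iy) dy = −2π` for `a < σ < c`** (the pole `c` to the right, `a` to the left of the line). [cite: Titchmarsh1939, §3.12] -/
theorem integral_kernel_vertical_of_between {a c σ : ℝ} (haσ : a < σ) (hσc : σ < c) :
    ∫ y : ℝ, ((c - a : ℝ) : ℂ) * ((((σ : ℂ) + y * I) - c) * (((σ : ℂ) + y * I) - a))⁻¹ = -2 * π := by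
  have hα : σ - c ≠ 0 := by linarith
  have hβ : σ - a ≠ 0 := by linarith
  have hca : ((c : ℂ) - a) ≠ 0 := by exact_mod_cast (sub_ne_zero.2 (haσ.trans hσc).ne')
  have h : (fun y : ℝ => ((c - a : ℝ) : ℂ) * ((((σ : ℂ) + y * I) - c) * (((σ : ℂ) + y * I) - a))⁻¹) =
      fun y : ℝ => ((c - a : ℝ) : ℂ) * ((((σ - c : ℝ) : ℂ) + y * I) * (((σ - a : ℝ) : ℂ) + y * I))⁻¹ := by
    funext y; push_cast; ring_nf
  rw [h, MeasureTheory.integral_const_mul, integral_inv_vertical_mul_vertical hα hβ (by linarith), abs_of_neg (by linarith : σ - c < 0), abs_of_pos (by linarith : 0 < σ - a),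
    div_self hβ, neg_div, div_self hα, show σ - a - (σ - c) = c - a by ring]
  push_cast
  field_simp
  ring

/-- The kernel is integrable on every vertical line `Re z = σ` with `σ ≠ c`, `σ ≠ a`. [folklore] -/
theorem integrable_kernel_vertical {a c σ : ℝ} (hσc : σ ≠ c) (hσa : σ ≠ a) :
    Integrable fun y : ℝ => ((c - a : ℝ) : ℂ) * ((((σ : ℂ) + y * I) - c) * (((σ : ℂ) + y * I) - a))⁻¹ := by
  have hα : σ - c ≠ 0 := sub_ne_zero.2 hσc
  have hβ : σ - a ≠ 0 := sub_ne_zero.2 hσa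
  have h : (fun y : ℝ => ((c - a : ℝ) : ℂ) * ((((σ : ℂ) + y * I) - c) * (((σ : ℂ) + y * I) - a))⁻¹) =
      fun y : ℝ => ((c - a : ℝ) : ℂ) * ((((σ - c : ℝ) : ℂ) + y * I) * (((σ - a : ℝ) : ℂ) + y * I))⁻¹ := by
    funext y; push_cast; ring_nf
  rw [h]
  exact (integrable_inv_vertical_mul_vertical hα hβ).const_mul _

/-- Uniform decay of the kernel on vertical lines: `‖k_{c,a}(x+iy)‖ ≤ |c − a|∕y²` for `y ≠ 0`, every real `x`. [folklore] -/
theorem norm_kernel_le (a c x : ℝ) {y : ℝ} (hy : y ≠ 0) :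
    ‖((c - a : ℝ) : ℂ) * ((((x : ℂ) + y * I) - c) * (((x : ℂ) + y * I) - a))⁻¹‖ ≤ |c - a| / y ^ 2 := by
  have hi1 : |y| ≤ ‖(x : ℂ) + y * I - c‖ := by
    have h := abs_im_le_norm ((x : ℂ) + y * I - c); simpa using h
  have hi2 : |y| ≤ ‖(x : ℂ) + y * I - a‖ := by
    have h := abs_im_le_norm ((x : ℂ) + y * I - a); simpa using h
  have hy2 : y ^ 2 = |y| * |y| := by rw [← sq, sq_abs]
  have hpos : 0 < |y| * |y| := by positivity
  rw [norm_mul, norm_inv, norm_mul, Complex.norm_real, Real.norm_eq_abs, hy2, div_eq_mul_inv]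
  exact mul_le_mul_of_nonneg_left (inv_anti₀ hpos (mul_le_mul hi1 hi2 (abs_nonneg _) (norm_nonneg _))) (abs_nonneg _)

/-- The kernel is complex-differentiable away from `c` and `a`. [folklore] -/
theorem differentiableAt_kernel {a c : ℝ} {z : ℂ} (hzc : z ≠ c) (hza : z ≠ a) :
    DifferentiableAt ℂ (fun z : ℂ => ((c - a : ℝ) : ℂ) * ((z - c) * (z - a))⁻¹) z := by
  have hne : (z - c) * (z - a) ≠ 0 := mul_ne_zero (sub_ne_zero.2 hzc) (sub_ne_zero.2 hza)
  exact (((differentiableAt_id.sub_const _).mul (differentiableAt_id.sub_const _)).inv hne).const_mul _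

/-- **RESIDUE `1` AT `c`**: `(z − c)·k_{c,a}(z) → 1` as `z → c`, `z ≠ c` (`(z−c)·k = (c−a)∕(z−a)` off `c`). [folklore] -/
theorem tendsto_sub_mul_kernel_self {a c : ℝ} (hac : a ≠ c) :
    Tendsto (fun z : ℂ => (z - c) * (((c - a : ℝ) : ℂ) * ((z - c) * (z - a))⁻¹)) (𝓝[≠] (c : ℂ)) (𝓝 1) := by
  have hca : (c : ℂ) - a ≠ 0 := by exact_mod_cast sub_ne_zero.2 (Ne.symm hac)
  have hcont : ContinuousAt (fun z : ℂ => ((c - a : ℝ) : ℂ) * (z - a)⁻¹) (c : ℂ) :=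
    (continuousAt_const.mul ((continuousAt_id.sub continuousAt_const).inv₀ hca))
  have hval : ((c - a : ℝ) : ℂ) * ((c : ℂ) - a)⁻¹ = 1 := by push_cast; field_simp
  have h1 : Tendsto (fun z : ℂ => ((c - a : ℝ) : ℂ) * (z - a)⁻¹) (𝓝[≠] (c : ℂ)) (𝓝 1) := by
    rw [← hval]; exact hcont.tendsto.mono_left nhdsWithin_le_nhds
  refine h1.congr' ?_
  filter_upwards [self_mem_nhdsWithin] with z hz
  have hzc : z - c ≠ 0 := sub_ne_zero.2 hz
  field_simp

/-- **NO RESIDUE ELSEWHERE**: `(z − c′)·k_{c,a}(z) → 0` as `z → c′` for `c′ ∉ {c, a}` (the kernel is continuous at `c′`). [folklore] -/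
theorem tendsto_sub_mul_kernel_other {a c : ℝ} {c' : ℂ} (hc : c' ≠ c) (ha : c' ≠ a) :
    Tendsto (fun z : ℂ => (z - c') * (((c - a : ℝ) : ℂ) * ((z - c) * (z - a))⁻¹)) (𝓝[≠] c') (𝓝 0) := by
  have hcont : ContinuousAt (fun z : ℂ => (z - c') * (((c - a : ℝ) : ℂ) * ((z - c) * (z - a))⁻¹)) c' :=
    (continuousAt_id.sub continuousAt_const).mul (differentiableAt_kernel hc ha).continuousAt
  have hval : (c' - c') * (((c - a : ℝ) : ℂ) * ((c' - c) * (c' - a))⁻¹) = 0 := by rw [sub_self, zero_mul]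
  rw [← hval]
  exact hcont.tendsto.mono_left nhdsWithin_le_nhds

/-! ## §2 Removable singularities on a finite set -/

/-- `(z − c)·f(z) → 0` at `c` ⟹ `f − f(c) = o((z − c)⁻¹)` on `𝓝[≠] c` (the hypothesis of Mathlib's removable-singularity theorem). [folklore] -/
theorem isLittleO_sub_inv_of_tendsto {f : ℂ → ℂ} {c : ℂ} (h : Tendsto (fun z : ℂ => (z - c) * f z) (𝓝[≠] c) (𝓝 0)) :
    (fun z : ℂ => f z - f c) =o[𝓝[≠] c] fun z : ℂ => (z - c)⁻¹ := by
  refine (isLittleO_iff_tendsto' ?_).2 ?_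
  · filter_upwards [self_mem_nhdsWithin] with z hz h0
    exact absurd (inv_eq_zero.1 h0) (sub_ne_zero.2 hz)
  · have h2 : Tendsto (fun z : ℂ => (z - c) * f c) (𝓝[≠] c) (𝓝 0) := by
      have h3 : Tendsto (fun z : ℂ => (z - c) * f c) (𝓝 c) (𝓝 ((c - c) * f c)) :=
        ((continuous_id.sub continuous_const).mul continuous_const).tendsto c
      rw [sub_self, zero_mul] at h3
      exact h3.mono_left nhdsWithin_le_nhds
    refine ((h.sub h2).congr' ?_).trans (by rw [sub_zero])
    filter_upwards [self_mem_nhdsWithin] with z hz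
    rw [div_inv_eq_mul]; ring

/-- **REMOVABLE SINGULARITIES ON A FINITE SET.**  `U` open, `S` a finite set, `f` complex-differentiable on `U ∖ S` with `(z − c)·f(z) → 0` (`z → c`, `z ≠ c`) at every `c ∈ S`: then
some `g` complex-differentiable on `U` agrees with `f` on `U ∖ S` (induction on `S`; one point = Mathlib `Complex.differentiableOn_update_limUnder_of_isLittleO`).
[cite: Titchmarsh1939, §3.1] -/
theorem exists_differentiableOn_eq_of_finset {U : Set ℂ} (hU : IsOpen U) (S : Finset ℂ) {f : ℂ → ℂ} (hf : DifferentiableOn ℂ f (U \ (S : Set ℂ)))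
    (h0 : ∀ c ∈ S, Tendsto (fun z : ℂ => (z - c) * f z) (𝓝[≠] c) (𝓝 0)) :
    ∃ g : ℂ → ℂ, DifferentiableOn ℂ g U ∧ ∀ z ∈ U \ (S : Set ℂ), g z = f z := by
  classical
  induction S using Finset.induction_on generalizing U with
  | empty => exact ⟨f, by simpa using hf, fun z _ => rfl⟩
  | @insert c S hcS ih =>
    -- continue across `S` on the open set `U ∖ {c}`
    have hU' : IsOpen (U \ {c}) := hU.sdiff isClosed_singleton
    have hf' : DifferentiableOn ℂ f ((U \ {c}) \ (S : Set ℂ)) := hf.mono fun z hz => ⟨hz.1.1, by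
      rw [Finset.coe_insert]; exact fun h => h.elim (fun h1 => hz.1.2 h1) (fun h2 => hz.2 h2)⟩
    obtain ⟨g', hg'd, hg'f⟩ := ih hU' hf' (fun c' hc' => h0 c' (Finset.mem_insert_of_mem hc'))
    by_cases hcU : c ∈ U
    · -- `g'` agrees with `f` on a punctured neighbourhood of `c`, so `(z − c)·g' → 0`; remove the singularity at `c`
      have hSc : (↑S : Set ℂ)ᶜ ∈ 𝓝 c := (S.finite_toSet.isClosed.isOpen_compl).mem_nhds (by simpa using hcS)
      have hev : ∀ᶠ z in 𝓝[≠] c, g' z = f z := by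
        filter_upwards [mem_nhdsWithin_of_mem_nhds (hU.mem_nhds hcU), mem_nhdsWithin_of_mem_nhds hSc, self_mem_nhdsWithin] with z hzU hzS hzc
        exact hg'f z ⟨⟨hzU, hzc⟩, hzS⟩
      have h0' : Tendsto (fun z : ℂ => (z - c) * g' z) (𝓝[≠] c) (𝓝 0) :=
        (h0 c (Finset.mem_insert_self c S)).congr' (hev.mono fun z hz => by simp only [hz])
      refine ⟨Function.update g' c (limUnder (𝓝[≠] c) g'), differentiableOn_update_limUnder_of_isLittleO (hU.mem_nhds hcU) hg'd (isLittleO_sub_inv_of_tendsto h0'), ?_⟩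
      intro z hz
      have hzc : z ≠ c := fun h => hz.2 (by rw [Finset.coe_insert, h]; exact mem_insert _ _)
      rw [Function.update_of_ne hzc]
      exact hg'f z ⟨⟨hz.1, hzc⟩, fun h => hz.2 (by rw [Finset.coe_insert]; exact mem_insert_of_mem _ h)⟩
    · -- `c ∉ U`: nothing to remove
      refine ⟨g', hg'd.mono fun z hz => ⟨hz, fun h => hcU (h ▸ hz)⟩, fun z hz => hg'f z ⟨⟨hz.1, fun h => hcU (h ▸ hz.1)⟩, ?_⟩⟩
      exact fun h => hz.2 (by rw [Finset.coe_insert]; exact mem_insert_of_mem _ h)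

/-! ## §3 Finitely many simple real poles between the lines: `∫_ℝ F(σ₂+iy) dy = ∫_ℝ F(σ₁+iy) dy + 2π·Σ_c Res_{z=c}F` -/

/-- **CONTOUR SHIFT ACROSS FINITELY MANY SIMPLE REAL POLES.**  `σ₁ < σ₂`; `S` a finite set of reals in `(σ₁, σ₂)`; `U` open containing the closed strip `{σ₁ ≤ Re z ≤ σ₂}`; `F`
complex-differentiable on `U ∖ S` with `(z − c)·F(z) → ρ_c` as `z → c` (`z ≠ c`) for every `c ∈ S`; `y ↦ F(σᵢ+iy)` integrable (`i = 1,2`); `‖F(x+iy)‖ ≤ K∕y²` for `x ∈ [σ₁, σ₂]`,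
`|y| ≥ 1`.  Then **`∫_ℝ F(σ₂+iy) dy = ∫_ℝ F(σ₁+iy) dy + 2π·Σ_{c ∈ S} ρ_c`**, i.e. `(2π)⁻¹∫_ℝ F(σ₂+iy) dy = (2π)⁻¹∫_ℝ F(σ₁+iy) dy + Σ_c Res_{z=c} F`.  Proof: with `a := σ₁ − 1`,
`G := F − Σ_c ρ_c·k_{c,a}` satisfies `(z − c)·G → 0` at each `c ∈ S` (§1 residues), hence has a holomorphic continuation `g` across `S` on `U ∩ {Re > a}` (§2); ★ T4a
`integral_vertical_eq_of_differentiableOn` shifts `g` (decay `(K + Σ_c ‖ρ_c‖(c − a))∕y²`); on the two lines `g = F − Σ_c ρ_c k_c` and §1 evaluates the kernels' integrals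
(`0` on `Re z = σ₂`, `−2π` on `Re z = σ₁`). [cite: Titchmarsh1939, §3.1, §3.12] [cite: MoeglinWaldspurger1995, II.2.1, IV.1.11] -/
theorem integral_vertical_eq_integral_vertical_add_sum_residues {F : ℂ → ℂ} {σ₁ σ₂ : ℝ} (hσ : σ₁ < σ₂) (S : Finset ℝ) (hS : ∀ c ∈ S, σ₁ < c ∧ c < σ₂)
    {U : Set ℂ} (hUo : IsOpen U) (hUs : {z : ℂ | σ₁ ≤ z.re ∧ z.re ≤ σ₂} ⊆ U)
    (hF : DifferentiableOn ℂ F (U \ ((S.image fun c : ℝ => (c : ℂ)) : Set ℂ)))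
    (ρ : ℝ → ℂ) (hρ : ∀ c ∈ S, Tendsto (fun z : ℂ => (z - c) * F z) (𝓝[≠] (c : ℂ)) (𝓝 (ρ c)))
    (h₁ : Integrable fun y : ℝ => F ((σ₁ : ℂ) + y * I)) (h₂ : Integrable fun y : ℝ => F ((σ₂ : ℂ) + y * I))
    {K : ℝ} (hK : ∀ x ∈ Icc σ₁ σ₂, ∀ y : ℝ, 1 ≤ |y| → ‖F ((x : ℂ) + y * I)‖ ≤ K / y ^ 2) :
    ∫ y : ℝ, F ((σ₂ : ℂ) + y * I) = (∫ y : ℝ, F ((σ₁ : ℂ) + y * I)) + 2 * π * ∑ c ∈ S, ρ c := by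
  classical
  -- the companion pole `a := σ₁ − 1` and the kernels `k_c := k_{c,a}`
  set a : ℝ := σ₁ - 1 with ha
  have haσ₁ : a < σ₁ := by rw [ha]; linarith
  have hac : ∀ c ∈ S, a < c := fun c hc => haσ₁.trans (hS c hc).1
  set k : ℝ → ℂ → ℂ := fun c z => ((c - a : ℝ) : ℂ) * ((z - c) * (z - a))⁻¹ with hk
  set Sℂ : Finset ℂ := S.image fun c : ℝ => (c : ℂ) with hSℂ
  have hmemS : ∀ z : ℂ, z ∈ (Sℂ : Set ℂ) ↔ ∃ c ∈ S, (c : ℂ) = z := fun z => by rw [hSℂ, Finset.coe_image]; exact mem_image _ _ _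
  -- the regularised function `G := F − Σ_c ρ_c k_c` on `U' := U ∩ {Re > a}`
  set G : ℂ → ℂ := fun z => F z - ∑ c ∈ S, ρ c * k c z with hG
  set U' : Set ℂ := U ∩ {z : ℂ | a < z.re} with hU'
  have hU'o : IsOpen U' := hUo.inter (isOpen_lt continuous_const continuous_re)
  have hkd : ∀ c ∈ S, DifferentiableOn ℂ (k c) (U' \ (Sℂ : Set ℂ)) := by
    intro c hc z hz
    refine (differentiableAt_kernel (fun h => hz.2 ((hmemS z).2 ⟨c, hc, h.symm⟩)) (fun h => ?_)).differentiableWithinAt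
    have := hz.1.2; simp only [mem_setOf_eq, h, ofReal_re] at this; exact lt_irrefl _ this
  have hGd : DifferentiableOn ℂ G (U' \ (Sℂ : Set ℂ)) :=
    (hF.mono fun z hz => ⟨hz.1.1, hz.2⟩).sub (DifferentiableOn.fun_sum fun c hc => (hkd c hc).const_mul _)
  -- the residues cancel: `(z − c)·G(z) → 0` at every pole
  have hres : ∀ c' ∈ Sℂ, Tendsto (fun z : ℂ => (z - c') * G z) (𝓝[≠] c') (𝓝 0) := by
    intro c' hc'
    obtain ⟨c, hc, rfl⟩ := Finset.mem_image.1 hc'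
    have hlim : ∀ c₂ ∈ S, Tendsto (fun z : ℂ => ρ c₂ * ((z - c) * k c₂ z)) (𝓝[≠] (c : ℂ)) (𝓝 (ρ c₂ * if c₂ = c then 1 else 0)) := by
      intro c₂ hc₂
      refine Tendsto.const_mul (ρ c₂) ?_
      by_cases h : c₂ = c
      · subst h; rw [if_pos rfl]; exact tendsto_sub_mul_kernel_self (hac c₂ hc₂).ne
      · rw [if_neg h]
        exact tendsto_sub_mul_kernel_other (fun h' => h (by exact_mod_cast h'.symm)) (fun h' => (hac c hc).ne' (by exact_mod_cast h'))
    have hsum := tendsto_finsetSum S hlim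
    simp only [mul_ite, mul_one, mul_zero, Finset.sum_ite_eq', if_pos hc] at hsum
    have h := (hρ c hc).sub hsum
    rw [sub_self] at h
    refine h.congr' (Eventually.of_forall fun z => ?_)
    simp only [hG, mul_sub, Finset.mul_sum]
    refine congrArg _ (Finset.sum_congr rfl fun c₂ _ => by ring)
  -- holomorphic continuation `g` across the poles
  obtain ⟨g, hgd, hgG⟩ := exists_differentiableOn_eq_of_finset hU'o Sℂ hGd hres
  -- off the real segment the continuation is `G`: on the two lines and at height `|y| ≥ 1`
  have hstripU' : {z : ℂ | σ₁ ≤ z.re ∧ z.re ≤ σ₂} ⊆ U' := fun z hz => ⟨hUs hz, lt_of_lt_of_le haσ₁ hz.1⟩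
  have hline : ∀ {σ : ℝ}, σ₁ ≤ σ → σ ≤ σ₂ → (∀ c ∈ S, σ ≠ c) → ∀ y : ℝ, g ((σ : ℂ) + y * I) = F ((σ : ℂ) + y * I) - ∑ c ∈ S, ρ c * k c ((σ : ℂ) + y * I) := by
    intro σ h1 h2 hne y
    refine hgG _ ⟨hstripU' ⟨by simpa using h1, by simpa using h2⟩, fun hz => ?_⟩
    obtain ⟨c, hc, hcz⟩ := (hmemS _).1 hz
    exact hne c hc (by have := congrArg Complex.re hcz; simpa using this.symm)
  have hne₁ : ∀ c ∈ S, σ₁ ≠ c := fun c hc => (hS c hc).1.ne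
  have hne₂ : ∀ c ∈ S, σ₂ ≠ c := fun c hc => (hS c hc).2.ne'
  have hg₁ : (fun y : ℝ => g ((σ₁ : ℂ) + y * I)) = fun y : ℝ => F ((σ₁ : ℂ) + y * I) - ∑ c ∈ S, ρ c * k c ((σ₁ : ℂ) + y * I) := funext (hline le_rfl hσ.le hne₁)
  have hg₂ : (fun y : ℝ => g ((σ₂ : ℂ) + y * I)) = fun y : ℝ => F ((σ₂ : ℂ) + y * I) - ∑ c ∈ S, ρ c * k c ((σ₂ : ℂ) + y * I) := funext (hline hσ.le le_rfl hne₂)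
  have hki₁ : ∀ c ∈ S, Integrable fun y : ℝ => ρ c * k c ((σ₁ : ℂ) + y * I) := fun c hc =>
    (integrable_kernel_vertical (hne₁ c hc) haσ₁.ne').const_mul _
  have hki₂ : ∀ c ∈ S, Integrable fun y : ℝ => ρ c * k c ((σ₂ : ℂ) + y * I) := fun c hc =>
    (integrable_kernel_vertical (hne₂ c hc) (haσ₁.trans hσ).ne').const_mul _
  have hgi₁ : Integrable fun y : ℝ => g ((σ₁ : ℂ) + y * I) := by rw [hg₁]; exact h₁.sub (integrable_finsetSum S hki₁)
  have hgi₂ : Integrable fun y : ℝ => g ((σ₂ : ℂ) + y * I) := by rw [hg₂]; exact h₂.sub (integrable_finsetSum S hki₂)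
  -- uniform decay of `g` on the strip at height `|y| ≥ 1`
  have hgK : ∀ x ∈ Icc σ₁ σ₂, ∀ y : ℝ, 1 ≤ |y| → ‖g ((x : ℂ) + y * I)‖ ≤ (K + ∑ c ∈ S, ‖ρ c‖ * |c - a|) / y ^ 2 := by
    intro x hx y hy
    have hy0 : y ≠ 0 := fun h0 => by rw [h0, abs_zero] at hy; linarith
    have hgz : g ((x : ℂ) + y * I) = G ((x : ℂ) + y * I) := by
      refine hgG _ ⟨hstripU' ⟨by simpa using hx.1, by simpa using hx.2⟩, fun hz => ?_⟩
      obtain ⟨c, -, hcz⟩ := (hmemS _).1 hz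
      exact hy0 (by have := congrArg Complex.im hcz; simpa using this.symm)
    rw [hgz]
    have hsum : ‖∑ c ∈ S, ρ c * k c ((x : ℂ) + y * I)‖ ≤ (∑ c ∈ S, ‖ρ c‖ * |c - a|) / y ^ 2 := by
      rw [Finset.sum_div]
      refine (norm_sum_le _ _).trans (Finset.sum_le_sum fun c _ => ?_)
      rw [norm_mul, mul_div_assoc]
      exact mul_le_mul_of_nonneg_left (norm_kernel_le a c x hy0) (norm_nonneg _)
    calc ‖F ((x : ℂ) + y * I) - ∑ c ∈ S, ρ c * k c ((x : ℂ) + y * I)‖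
        ≤ ‖F ((x : ℂ) + y * I)‖ + ‖∑ c ∈ S, ρ c * k c ((x : ℂ) + y * I)‖ := norm_sub_le _ _
      _ ≤ K / y ^ 2 + (∑ c ∈ S, ‖ρ c‖ * |c - a|) / y ^ 2 := add_le_add (hK x hx y hy) hsum
      _ = (K + ∑ c ∈ S, ‖ρ c‖ * |c - a|) / y ^ 2 := by ring
  obtain ⟨htop, hbot⟩ := tendsto_intervalIntegral_horizontal_of_sq_decay hσ.le hgK
  -- ★ T4a §2 for `g`, then the kernels' line integrals
  have hshift := integral_vertical_eq_of_differentiableOn hσ.le (hgd.mono hstripU') hgi₁ hgi₂ htop hbot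
  have hI₂ : ∫ y : ℝ, ∑ c ∈ S, ρ c * k c ((σ₂ : ℂ) + y * I) = 0 := by
    rw [integral_finsetSum S hki₂]
    refine Finset.sum_eq_zero fun c hc => ?_
    rw [MeasureTheory.integral_const_mul, integral_kernel_vertical_of_lt (hac c hc) (hS c hc).2, mul_zero]
  have hI₁ : ∫ y : ℝ, ∑ c ∈ S, ρ c * k c ((σ₁ : ℂ) + y * I) = -2 * π * ∑ c ∈ S, ρ c := by
    rw [integral_finsetSum S hki₁, Finset.mul_sum]
    refine Finset.sum_congr rfl fun c hc => ?_
    rw [MeasureTheory.integral_const_mul, integral_kernel_vertical_of_between haσ₁ (hS c hc).1]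
    ring
  rw [hg₁, hg₂, integral_sub h₂ (integrable_finsetSum S hki₂), integral_sub h₁ (integrable_finsetSum S hki₁), hI₁, hI₂, sub_zero] at hshift
  rw [hshift]
  ring

end Summit.HodgeConjecture.HodgeConjecture.Cruxes.H413.K2E1VerticalLineContourShiftMulti

end
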